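import Summits.ValiantsHypothesis.ValiantsHypothesis.Theorems.KPlusLogSqLawTropicalBHalvingProduct

/-!
# Route «KPlusLogSqLaw», crux `TropicalB` (stmt-ValiantsHypothesis-19771) — the HALVING PRODUCT LAW AT EVERY SIZE: the balanced halving
# recursion in square form `(T_D(m,K)+1)²·2^{C(⌊log₂ m⌋−2, 2)} ≤ K²·16^m`, and **`κ(m) ≤ m − 2` for EVERY `m ≥ 2^14`**
# (`κ(m) ≤ m − 1 − t` whenever `8t + 13⌊log₂ m⌋ + 6 ≤ ⌊log₂ m⌋²`)

HONEST FRAMING.  Second file of the helper pair (first: `…TropicalBHalvingProduct`, the dyadic sizes `m = 2^s`) toward the registered stubs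
`stub_tropThin` / `stub_tropFat` of `Cruxes/TropicalB/Lines/birth.lean` (crux `Summit.ValiantsHypothesis.ValiantsHypothesis.Theses.KPlusLogSqLaw.TropicalB`,
item stmt-ValiantsHypothesis-19771, route KPlusLogSqLaw; cell `pub-symmetroid`, seat val-sym-trop-p1 g20, 2026-08-28; `--supports … --as helper`).
UNCONDITIONAL census / structure bookkeeping in the unsigned currency `TropRowD`; nothing here bears on `TropicalB` in the bulk of its window, on
`WeakLifting`, DoorA26 / DoorA34, `MatrixDescartes` (stmt-ValiantsHypothesis-18050) or VP ≠ VNP.  Vocabulary as in the companion files: `(m, K)` is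
COUNTING-TIGHT iff `¬ TropRowD m K (multichoose K m − 2)`; `κ(m)` = the largest tight `K` (an initial segment, `Tightness.tropRowD_notTight_mono`);
state of record before this pair: `κ(m) < 16m` (`…TightnessCeiling`); `TropicalB ⇒ κ(m) = O(log m)` (`…TightnessThresholdLog`).

WHAT IS PROVED (elementary, in `ℕ`; the central-binomial estimates are the tree's `Literature.….UniformStep.centralBinom_sq_mul_le` and the first
file's `HalvingProduct.sixteen_pow_pred_le`, i.e. Mathlib's `Nat.four_pow_lt_mul_centralBinom`).
* §1 the potential `G(m) = 2^{C(⌊log₂ m⌋ − 2, 2)}`: `⌊log₂(2a)⌋ = ⌊log₂(2a+1)⌋ = ⌊log₂ a⌋ + 1`, one doubling multiplies `G` by `2^{⌊log₂ a⌋ − 2}`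
  (`pot_succ`), `G` is monotone (`pot_mono`).
* §2 **SQUARE-FORM HALVING LAW AT EVERY SIZE** (`halving_sq`): for `K ≥ 1` and every `m ≥ 1` there is `B` with `TropRowD m K B` and
  **`(B + 1)² · 2^{C(⌊log₂ m⌋ − 2, 2)} ≤ K² · 16^m`**, i.e. `T_D(m, K) + 1 ≤ K · 4^m / 2^{C(⌊log₂ m⌋−2,2)/2} = K·4^m / m^{(log₂ m)/4 − O(1)}`.
  Strong induction along BALANCED splits `m = a + a` / `a + (a+1)` with the landed halving inequality `tropRowD_halving`
  (`T_D(a+e)+1 ≤ C(a+e,a)·(T_D(a) + T_D(e) + 1)`), the Wallis bound `C(2a,a)²(3a+1) ≤ 16^a` at both parities (`C(2a+1,a) = C(2a+2,a+1)/2`),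
  and for the odd step the mixed estimate `(X+Y)²·G(a) ≤ 25·K²·16^a` from `X²G(a) ≤ K²16^a`, `Y²G(a) ≤ K²16^{a+1}` (`XY·G ≤ 4K²16^a` by squaring).
  The ratio `2^{⌊log₂ a⌋−2} ≤ a/4` is what the two steps can pay for (`4·ratio ≤ 3a+1`, `25·ratio ≤ 12a+16`).
* §3 **THE THRESHOLD IS BELOW THE DIAGONAL AT EVERY LARGE SIZE**: with `4·16^(m−1) ≤ m²·C(2m−1,m)²` and `C(2m−1,m) ≤ 3^t·C(2m−1−t,m)`
  (first file), a tight format `(m, m − t)` would force `2^{C(⌊log₂ m⌋−2,2)} ≤ 4·9^t·m⁴`; hence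
  `tropRowD_notTight_sub_of_pot : 4 ≤ m → 2t + 2 ≤ m → 4·9^t·m⁴ < 2^{C(⌊log₂ m⌋−2,2)} → TropRowD m (m − t) (multichoose (m − t) m − 2)`,
  `tropRowD_notTight_sub : 8t + 13·⌊log₂ m⌋ + 6 ≤ ⌊log₂ m⌋² → (same)` — **`κ(m) ≤ m − 1 − t`**, in particular (`t = 1`, `⌊log₂ m⌋ ≥ 14`)
  **`κ(m) ≤ m − 2` for every `m ≥ 16384`** (`tropRowD_notTight_pred`, `tropRowD_notTight_of_pred_le`: every `K ≥ m − 1` is non-tight), and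
  `κ(m) ≤ m − Ω(log₂² m)` for all large `m` (not only dyadic).  `TropicalB` predicts `κ(m) = O(log m)`.
[folklore: Wallis/Erdős central-binomial bounds; the rest is this cell's census bookkeeping]
-/

set_option linter.dupNamespace false
set_option autoImplicit false

namespace Summit.ValiantsHypothesis.ValiantsHypothesis.Theorems.KPlusLogSqLaw

open Finset
open scoped BigOperators

namespace HalvingProduct

/-! ### 1. The potential `G(m) = 2^{C(⌊log₂ m⌋ − 2, 2)}` -/

/-- `⌊log₂(2a)⌋ = ⌊log₂ a⌋ + 1` for `a ≥ 1`. [folklore] -/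
theorem log_two_add_self (a : ℕ) (ha : 1 ≤ a) : Nat.log 2 (a + a) = Nat.log 2 a + 1 := by
  rw [← mul_two]; exact Nat.log_mul_base (by norm_num) (by omega)

/-- `⌊log₂(2a+1)⌋ = ⌊log₂ a⌋ + 1` for `a ≥ 1`. [folklore] -/
theorem log_two_add_self_add_one (a : ℕ) (ha : 1 ≤ a) : Nat.log 2 (a + (a + 1)) = Nat.log 2 a + 1 := by
  apply Nat.log_eq_of_pow_le_of_lt_pow
  · have := Nat.pow_log_le_self 2 (x := a) (by omega)
    rw [pow_succ]; omega
  · have := Nat.lt_pow_succ_log_self (b := 2) (by norm_num) a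
    rw [pow_succ] at this
    rw [pow_succ, pow_succ]; omega

/-- one doubling of the size multiplies the potential by `2^{L−2}`: `2^{C(L+1−2,2)} = 2^{C(L−2,2)} · 2^{L−2}` (all `L`; for `L ≤ 2` both
extra factors are `1`). [arithmetic] -/
theorem pot_succ (L : ℕ) : 2 ^ ((L + 1 - 2).choose 2) = 2 ^ ((L - 2).choose 2) * 2 ^ (L - 2) := by
  rcases Nat.lt_or_ge L 2 with h | h
  · interval_cases L <;> simp
  · obtain ⟨n, rfl⟩ : ∃ n, L = n + 2 := ⟨L - 2, by omega⟩
    rw [show n + 2 + 1 - 2 = n + 1 by omega, show n + 2 - 2 = n by omega, Nat.choose_succ_succ', Nat.choose_one_right,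
      pow_add, mul_comm]

/-- the potential is monotone in the size. [arithmetic] -/
theorem pot_mono {a b : ℕ} (h : a ≤ b) : 2 ^ ((Nat.log 2 a - 2).choose 2) ≤ 2 ^ ((Nat.log 2 b - 2).choose 2) :=
  Nat.pow_le_pow_right (by norm_num) (Nat.choose_le_choose 2 (Nat.sub_le_sub_right (Nat.log_mono_right h) 2))

/-- the step budget: `2^{⌊log₂ a⌋ − 2} · 4 ≤ 3a + 1` and `2^{⌊log₂ a⌋ − 2} · 25 ≤ 12a + 16` for `a ≥ 1`. [arithmetic] -/
theorem ratio_budget (a : ℕ) (ha : 1 ≤ a) :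
    2 ^ (Nat.log 2 a - 2) * 4 ≤ 3 * a + 1 ∧ 2 ^ (Nat.log 2 a - 2) * 25 ≤ 12 * a + 16 := by
  have hpow := Nat.pow_log_le_self 2 (x := a) (by omega)
  rcases Nat.lt_or_ge (Nat.log 2 a) 2 with h | h
  · have : 2 ^ (Nat.log 2 a - 2) = 1 := by rw [show Nat.log 2 a - 2 = 0 by omega, pow_zero]
    rw [this]; omega
  · have e : 2 ^ Nat.log 2 a = 2 ^ (Nat.log 2 a - 2) * 4 := by
      rw [show (4 : ℕ) = 2 ^ 2 by norm_num, ← pow_add]; congr 1; omega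
    rw [e] at hpow
    omega

/-! ### 2. The square-form halving law at every size -/

/-- **SQUARE-FORM HALVING LAW AT EVERY SIZE.**  For `K ≥ 1` and every `m ≥ 1` there is a bound `B` of the unsigned row,
`TropRowD m K B`, with `(B + 1)² · 2^{C(⌊log₂ m⌋ − 2, 2)} ≤ K² · 16^m`. [this cell] -/
theorem halving_sq (K : ℕ) (hK : 1 ≤ K) : ∀ m : ℕ, 1 ≤ m →
    ∃ B, TropRowD m K B ∧ (B + 1) ^ 2 * 2 ^ ((Nat.log 2 m - 2).choose 2) ≤ K ^ 2 * 16 ^ m := by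
  intro m
  induction m using Nat.strong_induction_on with
  | _ m ih =>
  intro hm
  have hW : ∀ n : ℕ, n.centralBinom ^ 2 * (3 * n + 1) ≤ 16 ^ n :=
    Literature.Probability.LatticeModels.UniformStep.centralBinom_sq_mul_le
  obtain ⟨a, rfl | rfl⟩ := Nat.even_or_odd' m
  · -- even size `m = 2a`, `a ≥ 1`
    have ha : 1 ≤ a := by omega
    obtain ⟨B, hB, hineq⟩ := ih a (by omega) ha
    rw [two_mul]
    refine ⟨(a + a).choose a * (B + B + 1) - 1, tropRowD_halving hB hB, ?_⟩
    set G := 2 ^ ((Nat.log 2 a - 2).choose 2) with hG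
    set r := 2 ^ (Nat.log 2 a - 2) with hr
    set C := (a + a).choose a with hCdef
    have hlog : Nat.log 2 (a + a) = Nat.log 2 a + 1 := log_two_add_self a ha
    rw [hlog, pot_succ, ← hG, ← hr]
    have hC : 1 ≤ C := by rw [hCdef]; exact Nat.choose_pos (by omega)
    have hprod : 1 ≤ C * (B + B + 1) := Nat.mul_pos hC (by omega)
    have hWa : C ^ 2 * (3 * a + 1) ≤ 16 ^ a := by
      rw [hCdef, ← two_mul, ← Nat.centralBinom_eq_two_mul_choose]; exact hW a
    have h4r : r * 4 ≤ 3 * a + 1 := (ratio_budget a ha).1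
    calc (C * (B + B + 1) - 1 + 1) ^ 2 * (G * r) = (C * (B + B + 1)) ^ 2 * (G * r) := by rw [Nat.sub_add_cancel hprod]
      _ ≤ (C * (2 * (B + 1))) ^ 2 * (G * r) := by gcongr; omega
      _ = r * 4 * C ^ 2 * ((B + 1) ^ 2 * G) := by ring
      _ ≤ r * 4 * C ^ 2 * (K ^ 2 * 16 ^ a) := by gcongr
      _ = (r * 4) * (C ^ 2 * (K ^ 2 * 16 ^ a)) := by ring
      _ ≤ (3 * a + 1) * (C ^ 2 * (K ^ 2 * 16 ^ a)) := by gcongr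
      _ = (C ^ 2 * (3 * a + 1)) * (K ^ 2 * 16 ^ a) := by ring
      _ ≤ 16 ^ a * (K ^ 2 * 16 ^ a) := by gcongr
      _ = K ^ 2 * 16 ^ (a + a) := by rw [pow_add]; ring
  · -- odd size `m = 2a + 1`
    rcases Nat.eq_zero_or_pos a with rfl | ha
    · -- `m = 1`
      refine ⟨K - 1, by simpa using tropRowD_one K, ?_⟩
      simp only [Nat.mul_zero, Nat.zero_add, Nat.log_one_right, Nat.zero_sub, Nat.choose_zero_succ, pow_zero, mul_one, pow_one]
      have : K - 1 + 1 = K := by omega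
      rw [this]; nlinarith
    obtain ⟨B₁, hB₁, h₁⟩ := ih a (by omega) ha
    obtain ⟨B₂, hB₂, h₂⟩ := ih (a + 1) (by omega) (by omega)
    rw [show 2 * a + 1 = a + (a + 1) by ring]
    refine ⟨(a + (a + 1)).choose a * (B₁ + B₂ + 1) - 1, tropRowD_halving hB₁ hB₂, ?_⟩
    set G := 2 ^ ((Nat.log 2 a - 2).choose 2) with hG
    set G' := 2 ^ ((Nat.log 2 (a + 1) - 2).choose 2) with hG'
    set r := 2 ^ (Nat.log 2 a - 2) with hr
    set C := (a + (a + 1)).choose a with hCdef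
    set X := B₁ + 1 with hX
    set Y := B₂ + 1 with hY
    have hlog : Nat.log 2 (a + (a + 1)) = Nat.log 2 a + 1 := log_two_add_self_add_one a ha
    rw [hlog, pot_succ, ← hG, ← hr]
    have hGG' : G ≤ G' := pot_mono (Nat.le_succ a)
    have h₂' : Y ^ 2 * G ≤ K ^ 2 * 16 ^ (a + 1) := (Nat.mul_le_mul_left _ hGG').trans h₂
    -- the mixed estimate `(X+Y)²·G ≤ 25·K²·16^a`
    have hXY2 : (X * Y * G) ^ 2 ≤ (4 * K ^ 2 * 16 ^ a) ^ 2 := by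
      calc (X * Y * G) ^ 2 = (X ^ 2 * G) * (Y ^ 2 * G) := by ring
        _ ≤ (K ^ 2 * 16 ^ a) * (K ^ 2 * 16 ^ (a + 1)) := Nat.mul_le_mul h₁ h₂'
        _ = (4 * K ^ 2 * 16 ^ a) ^ 2 := by rw [pow_succ]; ring
    have hXY : X * Y * G ≤ 4 * K ^ 2 * 16 ^ a := (Nat.pow_le_pow_iff_left (by norm_num)).mp hXY2
    have hsum : (X + Y) ^ 2 * G ≤ 25 * (K ^ 2 * 16 ^ a) := by
      calc (X + Y) ^ 2 * G = X ^ 2 * G + 2 * (X * Y * G) + Y ^ 2 * G := by ring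
        _ ≤ K ^ 2 * 16 ^ a + 2 * (4 * K ^ 2 * 16 ^ a) + K ^ 2 * 16 ^ (a + 1) := by gcongr
        _ = 25 * (K ^ 2 * 16 ^ a) := by rw [pow_succ]; ring
    have hC : 1 ≤ C := by rw [hCdef]; exact Nat.choose_pos (by omega)
    have hprod : 1 ≤ C * (B₁ + B₂ + 1) := Nat.mul_pos hC (by omega)
    -- Wallis at `a + 1`: `(2C)²·(3a+4) ≤ 16^(a+1)` since `C(2a+2, a+1) = 2·C(2a+1, a)`
    have hWa : 4 * C ^ 2 * (3 * a + 4) ≤ 16 ^ (a + 1) := by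
      have h := hW (a + 1)
      rw [centralBinom_eq_two_mul_choose_pred (a + 1) (by omega), show 2 * (a + 1) - 1 = 2 * a + 1 by omega,
        Nat.choose_symm_half] at h
      have e : (2 * a + 1).choose a = C := by rw [hCdef]; congr 1; ring
      rw [e] at h
      calc 4 * C ^ 2 * (3 * a + 4) = (2 * C) ^ 2 * (3 * (a + 1) + 1) := by ring
        _ ≤ 16 ^ (a + 1) := h
    have h25r : r * 25 ≤ 12 * a + 16 := (ratio_budget a ha).2
    calc (C * (B₁ + B₂ + 1) - 1 + 1) ^ 2 * (G * r) = (C * (B₁ + B₂ + 1)) ^ 2 * (G * r) := by rw [Nat.sub_add_cancel hprod]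
      _ ≤ (C * (X + Y)) ^ 2 * (G * r) :=
          Nat.mul_le_mul_right _ (Nat.pow_le_pow_left (Nat.mul_le_mul_left _ (by omega)) 2)
      _ = r * C ^ 2 * ((X + Y) ^ 2 * G) := by ring
      _ ≤ r * C ^ 2 * (25 * (K ^ 2 * 16 ^ a)) := by gcongr
      _ = (r * 25) * C ^ 2 * (K ^ 2 * 16 ^ a) := by ring
      _ ≤ (12 * a + 16) * C ^ 2 * (K ^ 2 * 16 ^ a) := by gcongr
      _ = (4 * C ^ 2 * (3 * a + 4)) * (K ^ 2 * 16 ^ a) := by ring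
      _ ≤ 16 ^ (a + 1) * (K ^ 2 * 16 ^ a) := by gcongr
      _ = K ^ 2 * 16 ^ (a + (a + 1)) := by rw [pow_add, pow_add]; ring

/-- the law in plain form: **`T_D(m,K) + 1 ≤ K·4^m / 2^{C(⌊log₂ m⌋−2,2)/2}`**, written as `(T_D(m,K)+1)²·2^{C(⌊log₂ m⌋−2,2)} ≤ K²·16^m` for the
least bound; here for every chain directly: any unsigned dominant chain of `n + 1` terms satisfies `(n+1)²·2^{C(⌊log₂ m⌋−2,2)} ≤ K²·16^m`
(`K ≥ 1`, `m ≥ 1`). [this cell] -/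
theorem chain_sq_le (m K : ℕ) (hm : 1 ≤ m) (hK : 1 ≤ K) (d : Fin K → ℕ) (v ε : Fin m → Fin m → Fin K → ℤ) {n : ℕ}
    (θ : Fin (n + 1) → ℤ) (p : Fin (n + 1) → Equiv.Perm (Fin m) × (Fin m → Fin K)) (hθ : StrictMono θ)
    (hdom : ∀ k, MatrixDescartes.Negative.IsDominant d v ε (θ k) (p k)) (hne : ∀ k : Fin n, p k.castSucc ≠ p k.succ) :
    (n + 1) ^ 2 * 2 ^ ((Nat.log 2 m - 2).choose 2) ≤ K ^ 2 * 16 ^ m := by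
  obtain ⟨B, hB, hineq⟩ := halving_sq K hK m hm
  have hn : n ≤ B := hB d v ε n θ p hθ hdom hne
  calc (n + 1) ^ 2 * 2 ^ ((Nat.log 2 m - 2).choose 2) ≤ (B + 1) ^ 2 * 2 ^ ((Nat.log 2 m - 2).choose 2) := by gcongr
    _ ≤ K ^ 2 * 16 ^ m := hineq

/-! ### 3. The threshold is below the diagonal at every large size -/

/-- **Non-tightness criterion at `(m, m − t)` for every size**: if `4 ≤ m`, `2t + 2 ≤ m` and `4·9^t·m⁴ < 2^{C(⌊log₂ m⌋ − 2, 2)}`, then no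
design of format `(m, m − t)` carries a dominant chain through all `multichoose (m − t) m = C(2m−1−t, m)` class multisets. [this cell] -/
theorem tropRowD_notTight_sub_of_pot (m t : ℕ) (hm : 4 ≤ m) (ht : 2 * t + 2 ≤ m)
    (hpot : 4 * 9 ^ t * m ^ 4 < 2 ^ ((Nat.log 2 m - 2).choose 2)) :
    TropRowD m (m - t) (Nat.multichoose (m - t) m - 2) := by
  set G := 2 ^ ((Nat.log 2 m - 2).choose 2) with hG
  obtain ⟨B, hB, hineq⟩ := halving_sq (m - t) (by omega) m (by omega)
  rw [← hG] at hineq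
  have hN : Nat.multichoose (m - t) m = (2 * m - 1 - t).choose m := by
    rw [Nat.multichoose_eq]; congr 1; omega
  rw [hN]
  refine tropRowD_mono ?_ hB
  -- it remains: `B ≤ C(2m−1−t, m) − 2`, i.e. `B + 1 < C(2m−1−t, m)`
  suffices hmain : B + 1 < (2 * m - 1 - t).choose m by omega
  by_contra hcon
  push Not at hcon
  -- `C_t² · G ≤ (B+1)²·G ≤ (m−t)²·16^m ≤ m²·16^m`
  have h1 : ((2 * m - 1 - t).choose m) ^ 2 * G ≤ m ^ 2 * 16 ^ m := by
    calc ((2 * m - 1 - t).choose m) ^ 2 * G ≤ (B + 1) ^ 2 * G := by gcongr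
      _ ≤ (m - t) ^ 2 * 16 ^ m := hineq
      _ ≤ m ^ 2 * 16 ^ m := by gcongr; omega
  -- `C(2m−1, m) ≤ 3^t·C_t` and `4·16^(m−1) ≤ m²·C(2m−1,m)²`
  have h3 : (2 * m - 1).choose m ≤ 3 ^ t * (2 * m - 1 - t).choose m := choose_le_three_pow_mul_choose_sub m t ht
  have h16 : 4 * 16 ^ (m - 1) ≤ m ^ 2 * ((2 * m - 1).choose m) ^ 2 := sixteen_pow_pred_le m hm
  have e16 : (16 : ℕ) ^ m = 4 * (4 * 16 ^ (m - 1)) := by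
    rw [show m = m - 1 + 1 by omega, pow_succ, show m - 1 + 1 - 1 = m - 1 by omega]; ring
  have h9 : (3 ^ t) ^ 2 = 9 ^ t := by rw [← pow_mul, mul_comm, pow_mul]; norm_num
  have h2 : ((2 * m - 1 - t).choose m) ^ 2 * G ≤ ((2 * m - 1 - t).choose m) ^ 2 * (4 * 9 ^ t * m ^ 4) := by
    calc ((2 * m - 1 - t).choose m) ^ 2 * G ≤ m ^ 2 * 16 ^ m := h1
      _ = m ^ 2 * (4 * (4 * 16 ^ (m - 1))) := by rw [e16]
      _ ≤ m ^ 2 * (4 * (m ^ 2 * ((2 * m - 1).choose m) ^ 2)) := by gcongr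
      _ ≤ m ^ 2 * (4 * (m ^ 2 * (3 ^ t * (2 * m - 1 - t).choose m) ^ 2)) := by gcongr
      _ = ((2 * m - 1 - t).choose m) ^ 2 * (4 * (3 ^ t) ^ 2 * m ^ 4) := by ring
      _ = ((2 * m - 1 - t).choose m) ^ 2 * (4 * 9 ^ t * m ^ 4) := by rw [h9]
  have hCpos : 0 < ((2 * m - 1 - t).choose m) ^ 2 := pow_pos (Nat.choose_pos (by omega)) 2
  have h4 : G ≤ 4 * 9 ^ t * m ^ 4 := Nat.le_of_mul_le_mul_left h2 hCpos
  exact absurd hpot (not_lt.mpr h4)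

/-- **`κ(m) ≤ m − 1 − t` whenever `8t + 13⌊log₂ m⌋ + 6 ≤ ⌊log₂ m⌋²**: then the format `(m, m − t)` is not counting-tight
(`4·9^t·m⁴ < 2^{4t + 4⌊log₂ m⌋ + 6} ≤ 2^{C(⌊log₂ m⌋−2,2)}`). [this cell] -/
theorem tropRowD_notTight_sub (m t : ℕ) (h : 8 * t + 13 * Nat.log 2 m + 6 ≤ Nat.log 2 m * Nat.log 2 m) :
    TropRowD m (m - t) (Nat.multichoose (m - t) m - 2) := by
  set L := Nat.log 2 m with hL
  have hL14 : 14 ≤ L := by nlinarith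
  have hm0 : m ≠ 0 := by
    intro h0; rw [h0, Nat.log_zero_right] at hL; omega
  have hmlow : 2 ^ L ≤ m := Nat.pow_log_le_self 2 hm0
  have hmup : m < 2 ^ (L + 1) := Nat.lt_pow_succ_log_self (by norm_num) m
  have h14 : 2 ^ 14 ≤ 2 ^ L := Nat.pow_le_pow_right (by norm_num) hL14
  have hm : 4 ≤ m := by omega
  -- `2t + 2 ≤ m`: `8t ≤ L² ≤ 2^L ≤ m`
  have hsq : ∀ n : ℕ, 4 ≤ n → n * n ≤ 2 ^ n := by
    intro n hn
    induction n, hn using Nat.le_induction with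
    | base => norm_num
    | succ n hn ih =>
      have h2 : 2 * n + 1 ≤ n * n := by nlinarith
      calc (n + 1) * (n + 1) = n * n + (2 * n + 1) := by ring
        _ ≤ 2 ^ n + 2 ^ n := Nat.add_le_add ih (h2.trans ih)
        _ = 2 ^ (n + 1) := by rw [pow_succ]; ring
  have ht : 2 * t + 2 ≤ m := by nlinarith [hsq L (by omega)]
  refine tropRowD_notTight_sub_of_pot m t hm ht ?_
  -- the exponent comparison `4t + 4L + 6 ≤ C(L−2, 2)`
  obtain ⟨n, hn⟩ : ∃ n, L = n + 3 := ⟨L - 3, by omega⟩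
  have hC2 : (L - 2).choose 2 * 2 = (n + 1) * n := by
    rw [hn, show n + 3 - 2 = n + 1 by omega, Nat.choose_two_right, show n + 1 - 1 = n by omega]
    exact Nat.div_mul_cancel (by simpa [mul_comm] using (Nat.even_mul_succ_self n).two_dvd)
  have hsqL : L * L = n * n + 6 * n + 9 := by rw [hn]; ring
  have hprodn : (n + 1) * n = n * n + n := by ring
  have hexp : 4 * t + 4 * L + 6 ≤ (L - 2).choose 2 := by omega
  calc 4 * 9 ^ t * m ^ 4 < 4 * 9 ^ t * (2 ^ (L + 1)) ^ 4 := by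
        have : m ^ 4 < (2 ^ (L + 1)) ^ 4 := Nat.pow_lt_pow_left hmup (by norm_num)
        have h9 : 0 < 4 * 9 ^ t := by positivity
        exact Nat.mul_lt_mul_of_pos_left this h9
    _ ≤ 4 * 16 ^ t * (2 ^ (L + 1)) ^ 4 := by gcongr; norm_num
    _ = 2 ^ (4 * t + 4 * L + 6) := by
        rw [← pow_mul, show (16 : ℕ) = 2 ^ 4 by norm_num, ← pow_mul, show (4 : ℕ) = 2 ^ 2 by norm_num, ← pow_add, ← pow_add]
        congr 1; ring
    _ ≤ 2 ^ ((L - 2).choose 2) := Nat.pow_le_pow_right (by norm_num) hexp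

/-- **`κ(m) ≤ m − 2` for EVERY `m ≥ 2^14 = 16384`**: the format `(m, m − 1)` — strictly inside the crux window `⌊log₂ m⌋ + 1 < K < m` — is
not counting-tight. [this cell] -/
theorem tropRowD_notTight_pred (m : ℕ) (hm : 2 ^ 14 ≤ m) : TropRowD m (m - 1) (Nat.multichoose (m - 1) m - 2) := by
  apply tropRowD_notTight_sub m 1
  have hL : 14 ≤ Nat.log 2 m := by
    have := Nat.log_mono_right (b := 2) hm
    rwa [Nat.log_pow (by norm_num)] at this
  nlinarith

/-- … and, by propagation in `K` (`Tightness.tropRowD_notTight_mono`), NO format `(m, K)` with `K ≥ m − 1` is counting-tight once `m ≥ 2^14`;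
in particular the diagonal `(m, m)` and the whole super-fat corner. [this cell] -/
theorem tropRowD_notTight_of_pred_le (m K : ℕ) (hm : 2 ^ 14 ≤ m) (hK : m - 1 ≤ K) :
    TropRowD m K (Nat.multichoose K m - 2) :=
  Tightness.tropRowD_notTight_mono (by have h2 : (2 : ℕ) ^ 14 = 16384 := (by norm_num); omega) hK (tropRowD_notTight_pred m hm)

end HalvingProduct

end Summit.ValiantsHypothesis.ValiantsHypothesis.Theorems.KPlusLogSqLaw
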